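/-
Copyright (c) 2026 the pub-hodgecm-mathlib formalisation cell (harness21).  Prover seat hodgecm-mathlib-R90-C131-p05 (g0), HCML SLAB R90-TF,
section S4 «Ch. 13.1–2» (dealer K2E2-plan (g6)), ROAD «KEYS2-ANALYTIC» (MEMO `R90/R90-C131-p05/g0/MEMO-KEYS2-analytic-road.v1.md`), brick (ε2)
FILE B «TAIL VANISHING».  2026-09-04/05.
-/
import Summits.HodgeConjecture.HodgeConjecture.Theorems.R90S4Keys2TailDilation     -- ★ (this seat) (ε2) FILE A: `integral_annulus_tail_dilate_two`, `integrable_indicator_tail_two`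
import Summits.HodgeConjecture.HodgeConjecture.Theorems.R90S4U2OuterSimilSwap      -- ★ (R90-C131-p03): brings ★ `exists_conjLocal_eq_not_exists_norm` + ★ `exists_complexConj_eq_neg_ne_zero` (a NON-NORM `σ`-fixed unit)
import HarnessLib

/-!
# R90-TF · S4 — ROAD «KEYS2-ANALYTIC», brick (ε2) FILE B «TAIL VANISHING»: at a non-split `v`, for `χ₁|F_v^× = ω_{E/F}`, the annulus integrals of the tail
# `T = ‖·‖^{-1/2} χ₁(σ ·)⁻¹` over `{A/‖c‖ < nrm u₀₁ ≤ A}` VANISH for every norm `c = σ(z) z` — a five-line consequence of the dilation law, with NO shell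
# decomposition and NO ramified∕unramified case distinction

Cell `hodgecm-mathlib`, crux H413 (`stmt-HodgeConjecture-24833`, lane `--supports … --as helper`), route of record `HCCMUnconditional` (no route verbs;
count-neutral).  Programme R90-TF, section S4 (Rogawski Ch. 13.1–2, base `R90-C131`); seat R90-C131-p05 (g0).  THEOREMS ONLY (no `def`, no instance,
no notation, no named fact, no `sorry`); imports ★ only.

THE MATHEMATICS (the `U(1,1)` l.d.s. point [Rogawski1990, §11.1 p. 161]; [Keys1984, §3, §7]; [LabesseLanglands1979]).  Write `I(A′, A″)` for the integral of
`𝟙_{A′ < nrm u₀₁ ≤ A″} T(u₀₁)` over `N₂(L⁺_v)` (any Haar measure).  ★ FILE A gives the DILATION LAW `I(A′, A″) = χ₁(t)⁻¹ I(A′/‖t‖, A″/‖t‖)` for every `σ`-fixed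
unit `t`, and §1 gives ADDITIVITY over adjacent annuli.  Now (`hq : χ₁|F_v^× = ω`, ★ `IsQuadraticCharExtension`):
* (N) a norm `c = σ(z) z` is `σ`-fixed with `χ₁ c = 1`, so `I(A′, A″) = I(A′/‖c‖, A″/‖c‖)`, whence `I(A/‖c‖², A) = 2 I(A/‖c‖, A)` (`‖c‖ > 1`);
* (T) a NON-NORM `σ`-fixed unit `t₀` exists at a non-split place (★ `exists_conjLocal_eq_not_exists_norm`, index two), and `χ₁ t₀ = −1`
  (`χ₁ t₀ ≠ 1` by `hq`, `(χ₁ t₀)² = χ₁(σ t₀ · t₀) = 1`); replacing `t₀` by `t₀⁻¹` we may take `‖t₀‖ ≥ 1`;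
* (4) for ANY `σ`-fixed `s` with `χ₁ s = −1`, `‖s‖ ≥ 1`: `I(B/‖s‖², B) = I(B/‖s‖², B/‖s‖) + I(B/‖s‖, B) = −I(B/‖s‖, B) + I(B/‖s‖, B) = 0`;
* (5) `s = t₀ c` is `σ`-fixed with `χ₁ s = −1`: `0 = I(A/(‖t₀‖²‖c‖²), A) = I((A/‖c‖²)/‖t₀‖², A/‖c‖²) + I(A/‖c‖², A) = 0 + 2 I(A/‖c‖, A)`.
Hence **`I(A/‖c‖, A) = 0` for every norm `c` with `‖c‖ > 1` and every `A > 0`** — the `N = 2` replacement of ★ «KEYS (3) SHELL VANISHING AT THE CM PLACE»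
(`F0P3cStCharTSKeys3ShellVanishingCM`), where the `N = 3` road integrated a non-trivial character of the compact `E¹` over a fundamental domain; here the
relevant group `F^×/N E^× ≅ ℤ/2` is finite and the outer dilation by `t₀` does the work.
* §1 `integral_annulus_tail_add_two` (additivity); §2 `annulus_eq_zero_of_dilations` (the abstract five lines over `ℝ`); §3 `exists_fixed_unit_chi_eq_neg_one`,
  `chi_eq_one_of_norm`, **`integral_annulus_tail_eq_zero_of_norm_two`** (the displayed vanishing).
HONEST LABEL: HC_CM is proved only modulo the 7 printed citations (2 remaining named inputs: hLiu418 = stmt-HodgeConjecture-24832,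
h413 = stmt-HodgeConjecture-24833) until rung 0 closes; organ-level computation, closes nothing by itself; count-neutral.

## References
* [Rogawski1990] J. D. Rogawski, *Automorphic Representations of Unitary Groups in Three Variables*, Ann. of Math. Stud. 123 (1990), §11.1 p. 161, §12.1 p. 171,
  §3.5 Prop. 3.5.2 (a) p. 26.
* [Keys1984] D. Keys, *Principal series representations of special unitary groups over local fields*, Compositio Math. 51 (1984), §3, §7.
* [LabesseLanglands1979] J.-P. Labesse, R. P. Langlands, *L-indistinguishability for SL(2)*, Canad. J. Math. 31 (1979), 726–785.
* [Casselman1995] W. Casselman, *Introduction to the theory of admissible representations of 𝔭-adic reductive groups* (1995), §6.4.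
-/

set_option autoImplicit false
-- the mandated namespace (brief §3.4) repeats the single-problem summit's segment (`HodgeConjecture.HodgeConjecture`)
set_option linter.dupNamespace false

noncomputable section

open NumberField IsDedekindDomain MeasureTheory Measure Topology Filter Set
open scoped Matrix MatrixGroups NNReal ENNReal
open Literature.NumberTheory.Automorphic Literature.NumberTheory.Automorphic.UnitaryGroup Literature.NumberTheory.Automorphic.UnitaryGroup.HeisRing
open Literature.NumberTheory.GaloisRepresentations Literature.NumberTheory.GaloisRepresentations.IsNonarchimedeanLocalField
open Summit.HodgeConjecture.HodgeConjecture.Cruxes.H413.F0P3cStCharTSLocalRingNormDictionary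

namespace Summit.HodgeConjecture.HodgeConjecture.R90.S4

variable (L : Type) [Field L] [NumberField L] [IsCMField L] (v : HeightOneSpectrum (𝓞 ↥(maximalRealSubfield L)))
  (w : PlacesOver L v) (hw : IsCMField.complexConj L • w.1 = w.1)
  (χ₁ : (LocalRing L v)ˣ →* ℂˣ)

/-! ## §1 Additivity of the annulus integrals over adjacent annuli -/

open scoped Classical in
include hw in
set_option maxHeartbeats 1600000 in
/-- **`I(A₁, A₃) = I(A₁, A₂) + I(A₂, A₃)`** for `0 < A₁ ≤ A₂ ≤ A₃` (`𝟙_{(A₁,A₃]} = 𝟙_{(A₁,A₂]} + 𝟙_{(A₂,A₃]}` pointwise; both truncated tails are integrable ★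
`integrable_indicator_tail_two`). [cite: Casselman1995, §6.4] [cite: Keys1984, §7] -/
theorem integral_annulus_tail_add_two [MeasurableSpace ↥(cmBorelTriple L 2 v).N] [BorelSpace ↥(cmBorelTriple L 2 v).N]
    (hns : ∀ w' : PlacesOver L v, IsCMField.complexConj L • w'.1 = w'.1) (h1 : Continuous fun x => ((χ₁ x : ℂˣ) : ℂ))
    (hq : IsQuadraticCharExtension (conjLocal L (IsCMField.complexConj L) v) χ₁)
    (μ : Measure ↥(cmBorelTriple L 2 v).N) [μ.IsHaarMeasure] {A₁ A₂ A₃ : ℝ} (h0 : 0 < A₁) (h12 : A₁ ≤ A₂) (h23 : A₂ ≤ A₃) :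
    ∫ u : ↥(cmBorelTriple L 2 v).N,
      ((fun b : LocalRing L v => ((∏ w' : PlacesOver L v, normAbs (w'.1.adicCompletion L) (b w') : ℝ≥0) : ℝ)) ⁻¹' Set.Ioc A₁ A₃).indicator
        (fun b : LocalRing L v => (((NNReal.sqrt (∏ w' : PlacesOver L v, normAbs (w'.1.adicCompletion L) (b w')))⁻¹ : ℝ≥0) : ℂ) *
          (fun b : LocalRing L v => if hb : IsUnit b then
            (((χ₁ (Units.map (conjLocal L (IsCMField.complexConj L) v : LocalRing L v →* LocalRing L v) hb.unit))⁻¹ : ℂˣ) : ℂ) else 0) b)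
        (Units.val ((u : ↥(unitaryGroupOfForm (conjLocal L (IsCMField.complexConj L) v) (cmLocalForm L 2 v))) : GL (Fin 2) (LocalRing L v)) 0 1) ∂μ =
      (∫ u : ↥(cmBorelTriple L 2 v).N,
        ((fun b : LocalRing L v => ((∏ w' : PlacesOver L v, normAbs (w'.1.adicCompletion L) (b w') : ℝ≥0) : ℝ)) ⁻¹' Set.Ioc A₁ A₂).indicator
          (fun b : LocalRing L v => (((NNReal.sqrt (∏ w' : PlacesOver L v, normAbs (w'.1.adicCompletion L) (b w')))⁻¹ : ℝ≥0) : ℂ) *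
            (fun b : LocalRing L v => if hb : IsUnit b then
              (((χ₁ (Units.map (conjLocal L (IsCMField.complexConj L) v : LocalRing L v →* LocalRing L v) hb.unit))⁻¹ : ℂˣ) : ℂ) else 0) b)
          (Units.val ((u : ↥(unitaryGroupOfForm (conjLocal L (IsCMField.complexConj L) v) (cmLocalForm L 2 v))) : GL (Fin 2) (LocalRing L v)) 0 1) ∂μ) +
      ∫ u : ↥(cmBorelTriple L 2 v).N,
        ((fun b : LocalRing L v => ((∏ w' : PlacesOver L v, normAbs (w'.1.adicCompletion L) (b w') : ℝ≥0) : ℝ)) ⁻¹' Set.Ioc A₂ A₃).indicator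
          (fun b : LocalRing L v => (((NNReal.sqrt (∏ w' : PlacesOver L v, normAbs (w'.1.adicCompletion L) (b w')))⁻¹ : ℝ≥0) : ℂ) *
            (fun b : LocalRing L v => if hb : IsUnit b then
              (((χ₁ (Units.map (conjLocal L (IsCMField.complexConj L) v : LocalRing L v →* LocalRing L v) hb.unit))⁻¹ : ℂˣ) : ℂ) else 0) b)
          (Units.val ((u : ↥(unitaryGroupOfForm (conjLocal L (IsCMField.complexConj L) v) (cmLocalForm L 2 v))) : GL (Fin 2) (LocalRing L v)) 0 1) ∂μ := by
  rw [← integral_add (integrable_indicator_tail_two L v w hw χ₁ hns h1 hq μ h0) (integrable_indicator_tail_two L v w hw χ₁ hns h1 hq μ (lt_of_lt_of_le h0 h12))]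
  refine integral_congr_ae (Filter.Eventually.of_forall fun u => ?_)
  -- pointwise: `𝟙_{(A₁,A₃]} = 𝟙_{(A₁,A₂]} + 𝟙_{(A₂,A₃]}`
  set b : LocalRing L v := Units.val ((u : ↥(unitaryGroupOfForm (conjLocal L (IsCMField.complexConj L) v) (cmLocalForm L 2 v))) : GL (Fin 2) (LocalRing L v)) 0 1
    with hb
  set x : ℝ := ((∏ w' : PlacesOver L v, normAbs (w'.1.adicCompletion L) (b w') : ℝ≥0) : ℝ) with hx
  have m13 : b ∈ (fun b : LocalRing L v => ((∏ w' : PlacesOver L v, normAbs (w'.1.adicCompletion L) (b w') : ℝ≥0) : ℝ)) ⁻¹' Set.Ioc A₁ A₃ ↔ A₁ < x ∧ x ≤ A₃ :=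
    Iff.rfl
  have m12 : b ∈ (fun b : LocalRing L v => ((∏ w' : PlacesOver L v, normAbs (w'.1.adicCompletion L) (b w') : ℝ≥0) : ℝ)) ⁻¹' Set.Ioc A₁ A₂ ↔ A₁ < x ∧ x ≤ A₂ :=
    Iff.rfl
  have m23 : b ∈ (fun b : LocalRing L v => ((∏ w' : PlacesOver L v, normAbs (w'.1.adicCompletion L) (b w') : ℝ≥0) : ℝ)) ⁻¹' Set.Ioc A₂ A₃ ↔ A₂ < x ∧ x ≤ A₃ :=
    Iff.rfl
  beta_reduce
  by_cases h₁ : x ≤ A₁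
  · rw [Set.indicator_of_notMem (fun h => not_lt.2 h₁ (m13.1 h).1), Set.indicator_of_notMem (fun h => not_lt.2 h₁ (m12.1 h).1),
      Set.indicator_of_notMem (fun h => not_lt.2 (le_trans h₁ h12) (m23.1 h).1), add_zero]
  rw [not_le] at h₁
  by_cases h₂ : x ≤ A₂
  · rw [Set.indicator_of_mem (m13.2 ⟨h₁, le_trans h₂ h23⟩), Set.indicator_of_mem (m12.2 ⟨h₁, h₂⟩),
      Set.indicator_of_notMem (fun h => not_lt.2 h₂ (m23.1 h).1), add_zero]
  rw [not_le] at h₂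
  by_cases h₃ : x ≤ A₃
  · rw [Set.indicator_of_mem (m13.2 ⟨h₁, h₃⟩), Set.indicator_of_notMem (fun h => not_le.2 h₂ (m12.1 h).2),
      Set.indicator_of_mem (m23.2 ⟨h₂, h₃⟩), zero_add]
  · rw [Set.indicator_of_notMem (fun h => h₃ (m13.1 h).2), Set.indicator_of_notMem (fun h => h₃ (le_trans (m12.1 h).2 h23)),
      Set.indicator_of_notMem (fun h => h₃ (m23.1 h).2), add_zero]

/-! ## §2 The abstract five lines: additivity + a norm dilation + a sign-reversing dilation ⇒ the annulus integral vanishes -/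

/-- **(4): a SIGN-REVERSING dilation kills the double annulus** — if `I` is additive over adjacent annuli in `(0, ∞)` and `I(A′, A″) = −I(A′/p, A″/p)` for some
`p ≥ 1`, then `I(B/p², B) = 0` for every `B > 0` (`= I(B/p², B/p) + I(B/p, B) = −I(B/p, B) + I(B/p, B)`). [cite: Rogawski1990, §11.1 p. 161] [cite: Keys1984, §3] -/
theorem annulus_eq_zero_of_neg_dilation (I : ℝ → ℝ → ℂ)
    (hadd : ∀ A₁ A₂ A₃ : ℝ, 0 < A₁ → A₁ ≤ A₂ → A₂ ≤ A₃ → I A₁ A₃ = I A₁ A₂ + I A₂ A₃)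
    {p : ℝ} (hp : 1 ≤ p) (hdil : ∀ A' A'' : ℝ, I A' A'' = -I (A' / p) (A'' / p)) {B : ℝ} (hB : 0 < B) :
    I (B / p ^ 2) B = 0 := by
  have hp0 : 0 < p := lt_of_lt_of_le one_pos hp
  have h1 : B / p ^ 2 ≤ B / p := by
    rw [div_le_div_iff_of_pos_left hB (pow_pos hp0 2) hp0]
    nlinarith
  have h2 : B / p ≤ B := div_le_self hB.le hp
  have hsplit := hadd (B / p ^ 2) (B / p) B (div_pos hB (pow_pos hp0 2)) h1 h2
  have hd := hdil (B / p) B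
  rw [div_div, ← sq] at hd
  rw [hsplit, hd, add_neg_cancel]

/-- **THE ABSTRACT FIVE LINES.**  `I` additive over adjacent annuli in `(0, ∞)`; `q > 1` with the NORM dilation `I(A′, A″) = I(A′/q, A″/q)`; `p ≥ 1` with SIGN-REVERSING
dilations by `p` and by `p q`.  Then `I(A/q, A) = 0` for every `A > 0`: (3) `I(A/q², A) = 2 I(A/q, A)`; (4) `I(B/p², B) = 0`, `I(B/(pq)², B) = 0`;
(5) `0 = I(A/(pq)², A) = I((A/q²)/p², A/q²) + I(A/q², A) = 2 I(A/q, A)`. [cite: Rogawski1990, §11.1 p. 161] [cite: Keys1984, §3, §7] -/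
theorem annulus_eq_zero_of_dilations (I : ℝ → ℝ → ℂ)
    (hadd : ∀ A₁ A₂ A₃ : ℝ, 0 < A₁ → A₁ ≤ A₂ → A₂ ≤ A₃ → I A₁ A₃ = I A₁ A₂ + I A₂ A₃)
    {q : ℝ} (hq : 1 < q) (hdil_c : ∀ A' A'' : ℝ, I A' A'' = I (A' / q) (A'' / q))
    {p : ℝ} (hp : 1 ≤ p) (hdil_t : ∀ A' A'' : ℝ, I A' A'' = -I (A' / p) (A'' / p))
    (hdil_tc : ∀ A' A'' : ℝ, I A' A'' = -I (A' / (p * q)) (A'' / (p * q))) {A : ℝ} (hA : 0 < A) :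
    I (A / q) A = 0 := by
  have hq0 : 0 < q := lt_trans one_pos hq
  have hp0 : 0 < p := lt_of_lt_of_le one_pos hp
  -- (3) `I(A/q², A) = 2 I(A/q, A)`
  have h3 : I (A / q ^ 2) A = 2 * I (A / q) A := by
    have h1' : A / q ^ 2 ≤ A / q := by
      rw [div_le_div_iff_of_pos_left hA (pow_pos hq0 2) hq0]
      nlinarith
    have hsplit := hadd (A / q ^ 2) (A / q) A (div_pos hA (pow_pos hq0 2)) h1' (div_le_self hA.le hq.le)
    have hd := hdil_c (A / q) A
    rw [div_div, ← sq] at hd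
    rw [hsplit, ← hd, two_mul]
  -- (4) for `p q` at `A`, and for `p` at `A/q²`
  have hpq : 1 ≤ p * q := by nlinarith
  have h4 := annulus_eq_zero_of_neg_dilation I hadd hpq hdil_tc hA
  have h4' := annulus_eq_zero_of_neg_dilation I hadd hp hdil_t (div_pos hA (pow_pos hq0 2))
  -- (5) split `I(A/(pq)², A)` at `A/q²`
  have hle1 : A / (p * q) ^ 2 ≤ A / q ^ 2 := by
    rw [div_le_div_iff_of_pos_left hA (pow_pos (mul_pos hp0 hq0) 2) (pow_pos hq0 2), mul_pow]
    nlinarith [pow_pos hq0 2, one_le_pow₀ (n := 2) hp]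
  have hsplit := hadd (A / (p * q) ^ 2) (A / q ^ 2) A (div_pos hA (pow_pos (mul_pos hp0 hq0) 2)) hle1 (div_le_self hA.le (one_le_pow₀ hq.le))
  have heq : A / q ^ 2 / p ^ 2 = A / (p * q) ^ 2 := by rw [div_div, mul_pow, mul_comm]
  rw [heq] at h4'
  rw [h4', zero_add, h3] at hsplit
  -- `0 = 2 I(A/q, A)`
  have h2 : (2 : ℂ) * I (A / q) A = 0 := hsplit.symm.trans h4
  exact (mul_eq_zero.1 h2).resolve_left two_ne_zero

/-! ## §3 The CM instance: norms have `χ₁ = 1`, a non-norm `σ`-fixed unit has `χ₁ = −1`, and the annulus integrals of the tail vanish -/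

/-- **(N) `χ₁(σ(z) z) = 1`** (`hq`: on `σ`-fixed units `χ₁` is trivial exactly on the norms). [cite: Rogawski1990, §11.1 p. 161; §4.8 p. 51] -/
theorem chi_eq_one_of_norm (hq : IsQuadraticCharExtension (conjLocal L (IsCMField.complexConj L) v) χ₁) (z : (LocalRing L v)ˣ) :
    χ₁ (Units.map (conjLocal L (IsCMField.complexConj L) v : LocalRing L v →* LocalRing L v) z * z) = 1 := by
  have hfix : conjLocal L (IsCMField.complexConj L) v
      (((Units.map (conjLocal L (IsCMField.complexConj L) v : LocalRing L v →* LocalRing L v) z * z : (LocalRing L v)ˣ)) : LocalRing L v) =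
      (Units.map (conjLocal L (IsCMField.complexConj L) v : LocalRing L v →* LocalRing L v) z * z : (LocalRing L v)ˣ) := by
    rw [Units.val_mul, Units.coe_map, MonoidHom.coe_coe, map_mul, conjLocal_conjLocal_cm L v, mul_comm]
  exact (hq _ hfix).2 ⟨z, by rw [Units.val_mul, Units.coe_map, MonoidHom.coe_coe]⟩

include hw in
/-- **(T) A NON-NORM `σ`-FIXED UNIT HAS `χ₁ = −1`** at a non-split `v` (★ `exists_conjLocal_eq_not_exists_norm`: `F_v^×/N E_w^×` has index `2`; `χ₁ t ≠ 1` by `hq`, and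
`(χ₁ t)² = χ₁(σt · t) = 1`). [cite: Rogawski1990, §3.5 Prop. 3.5.2 (a) p. 26; §11.1 p. 161] [cite: Omeara1963, §63B Prop. 63:13] -/
theorem exists_fixed_unit_chi_eq_neg_one (hq : IsQuadraticCharExtension (conjLocal L (IsCMField.complexConj L) v) χ₁) :
    ∃ t : (LocalRing L v)ˣ, conjLocal L (IsCMField.complexConj L) v (t : LocalRing L v) = t ∧ ((χ₁ t : ℂˣ) : ℂ) = -1 := by
  obtain ⟨δ, hcδ, hδ⟩ := Literature.NumberTheory.Weil1982.UnitaryFinTopForm.exists_complexConj_eq_neg_ne_zero L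
  obtain ⟨r, hr, hru, hnr⟩ := exists_conjLocal_eq_not_exists_norm L v (IsCMField.complexConj L) hcδ hδ w hw
  refine ⟨hru.unit, by rw [hru.unit_spec]; exact hr, ?_⟩
  have hfix : conjLocal L (IsCMField.complexConj L) v (hru.unit : LocalRing L v) = hru.unit := by rw [hru.unit_spec]; exact hr
  -- `χ₁ t ≠ 1`
  have hne : χ₁ hru.unit ≠ 1 := by
    intro h1
    obtain ⟨y, hy⟩ := (hq hru.unit hfix).1 h1
    exact hnr ⟨y, Units.isUnit y, by rw [← hru.unit_spec, ← hy]⟩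
  -- `(χ₁ t)² = 1`
  have hsq : χ₁ hru.unit * χ₁ hru.unit = 1 := by
    rw [← map_mul]
    have hfix2 : conjLocal L (IsCMField.complexConj L) v (((hru.unit * hru.unit : (LocalRing L v)ˣ)) : LocalRing L v) = (hru.unit * hru.unit : (LocalRing L v)ˣ) := by
      rw [Units.val_mul, map_mul, hfix]
    exact (hq _ hfix2).2 ⟨hru.unit, by rw [hfix, Units.val_mul]⟩
  have hsq' : ((χ₁ hru.unit : ℂˣ) : ℂ) * ((χ₁ hru.unit : ℂˣ) : ℂ) = 1 := by rw [← Units.val_mul, hsq, Units.val_one]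
  rcases mul_self_eq_one_iff.1 hsq' with h | h
  · exact absurd (Units.val_eq_one.1 h) hne
  · exact h

open scoped Classical in
include hw in
set_option maxHeartbeats 3200000 in
/-- **«TAIL VANISHING AT THE l.d.s. POINT OF `U(1,1)`».**  `v` non-split, `χ₁` continuous with `χ₁|F_v^× = ω_{E/F}` (`hq`), `μ` ANY Haar measure of `N₂(L⁺_v)`.  For every
unit `z`, with `c = σ(z) z` of module `‖c‖ > 1`, and every `A > 0`:
  `∫_{N₂} 𝟙_{A/‖c‖ < nrm u₀₁ ≤ A} · T(u₀₁) dμ(u) = 0`,   `T(b) = (√nrm b)⁻¹ · χ₁(σ b̂)⁻¹`.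
Proof: §2 with `q = ‖c‖` (★ dilation law at `t = c`, `χ₁ c = 1`), `p = ‖t₀‖^{±1} ≥ 1` for the non-norm fixed unit `t₀` of (T) (★ dilation law at `t = t₀^{±1}` and at
`t = t₀^{±1} c`, both with `χ₁ = −1`). [cite: Rogawski1990, §11.1 p. 161; §12.1 p. 171] [cite: Keys1984, §3, §7] [cite: LabesseLanglands1979, §2] -/
theorem integral_annulus_tail_eq_zero_of_norm_two [MeasurableSpace ↥(cmBorelTriple L 2 v).N] [BorelSpace ↥(cmBorelTriple L 2 v).N]
    (hns : ∀ w' : PlacesOver L v, IsCMField.complexConj L • w'.1 = w'.1) (h1 : Continuous fun x => ((χ₁ x : ℂˣ) : ℂ))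
    (hq : IsQuadraticCharExtension (conjLocal L (IsCMField.complexConj L) v) χ₁)
    (μ : Measure ↥(cmBorelTriple L 2 v).N) [μ.IsHaarMeasure]
    (z : (LocalRing L v)ˣ)
    (hc : 1 < distribHaarChar (LocalRing L v) (Units.map (conjLocal L (IsCMField.complexConj L) v : LocalRing L v →* LocalRing L v) z * z))
    {A : ℝ} (hA : 0 < A) :
    ∫ u : ↥(cmBorelTriple L 2 v).N,
      ((fun b : LocalRing L v => ((∏ w' : PlacesOver L v, normAbs (w'.1.adicCompletion L) (b w') : ℝ≥0) : ℝ)) ⁻¹'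
          Set.Ioc (A / (distribHaarChar (LocalRing L v) (Units.map (conjLocal L (IsCMField.complexConj L) v : LocalRing L v →* LocalRing L v) z * z) : ℝ)) A).indicator
        (fun b : LocalRing L v => (((NNReal.sqrt (∏ w' : PlacesOver L v, normAbs (w'.1.adicCompletion L) (b w')))⁻¹ : ℝ≥0) : ℂ) *
          (fun b : LocalRing L v => if hb : IsUnit b then
            (((χ₁ (Units.map (conjLocal L (IsCMField.complexConj L) v : LocalRing L v →* LocalRing L v) hb.unit))⁻¹ : ℂˣ) : ℂ) else 0) b)
        (Units.val ((u : ↥(unitaryGroupOfForm (conjLocal L (IsCMField.complexConj L) v) (cmLocalForm L 2 v))) : GL (Fin 2) (LocalRing L v)) 0 1) ∂μ = 0 := by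
  -- the annulus integral as a function of the two radii
  set I : ℝ → ℝ → ℂ := fun A' A'' => ∫ u : ↥(cmBorelTriple L 2 v).N,
      ((fun b : LocalRing L v => ((∏ w' : PlacesOver L v, normAbs (w'.1.adicCompletion L) (b w') : ℝ≥0) : ℝ)) ⁻¹' Set.Ioc A' A'').indicator
        (fun b : LocalRing L v => (((NNReal.sqrt (∏ w' : PlacesOver L v, normAbs (w'.1.adicCompletion L) (b w')))⁻¹ : ℝ≥0) : ℂ) *
          (fun b : LocalRing L v => if hb : IsUnit b then
            (((χ₁ (Units.map (conjLocal L (IsCMField.complexConj L) v : LocalRing L v →* LocalRing L v) hb.unit))⁻¹ : ℂˣ) : ℂ) else 0) b)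
        (Units.val ((u : ↥(unitaryGroupOfForm (conjLocal L (IsCMField.complexConj L) v) (cmLocalForm L 2 v))) : GL (Fin 2) (LocalRing L v)) 0 1) ∂μ with hI
  -- additivity and the dilation law (★ FILE A), in terms of `I`
  have hadd : ∀ A₁ A₂ A₃ : ℝ, 0 < A₁ → A₁ ≤ A₂ → A₂ ≤ A₃ → I A₁ A₃ = I A₁ A₂ + I A₂ A₃ :=
    fun A₁ A₂ A₃ h0 h12 h23 => integral_annulus_tail_add_two L v w hw χ₁ hns h1 hq μ h0 h12 h23
  have hdil : ∀ (t : (LocalRing L v)ˣ) (ht : conjLocal L (IsCMField.complexConj L) v (t : LocalRing L v) = t) (A' A'' : ℝ),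
      I A' A'' = (((χ₁ t)⁻¹ : ℂˣ) : ℂ) * I (A' / (distribHaarChar (LocalRing L v) t : ℝ)) (A'' / (distribHaarChar (LocalRing L v) t : ℝ)) :=
    fun t ht A' A'' => integral_annulus_tail_dilate_two L v χ₁ t ht μ A' A''
  -- (N) the norm `c = σ(z) z`: fixed, `χ₁ c = 1`, module `q > 1`
  set c : (LocalRing L v)ˣ := Units.map (conjLocal L (IsCMField.complexConj L) v : LocalRing L v →* LocalRing L v) z * z with hcdef
  have hcfix : conjLocal L (IsCMField.complexConj L) v (c : LocalRing L v) = c := by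
    rw [hcdef, Units.val_mul, Units.coe_map, MonoidHom.coe_coe, map_mul, conjLocal_conjLocal_cm L v, mul_comm]
  have hχc : χ₁ c = 1 := chi_eq_one_of_norm L v χ₁ hq z
  set q : ℝ := (distribHaarChar (LocalRing L v) c : ℝ) with hqdef
  have hq1 : 1 < q := by rw [hqdef]; exact_mod_cast hc
  have hdil_c : ∀ A' A'' : ℝ, I A' A'' = I (A' / q) (A'' / q) := by
    intro A' A''
    rw [hdil c hcfix A' A'', hχc, inv_one, Units.val_one, one_mul]
  -- (T) a non-norm fixed unit `t₀` with `χ₁ t₀ = −1`, normalised to `‖t₀‖ ≥ 1`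
  obtain ⟨t₁, ht₁, hχt₁⟩ := exists_fixed_unit_chi_eq_neg_one L v w hw χ₁ hq
  obtain ⟨t₀, ht₀, hχt₀, hp⟩ : ∃ t₀ : (LocalRing L v)ˣ, conjLocal L (IsCMField.complexConj L) v (t₀ : LocalRing L v) = t₀ ∧ ((χ₁ t₀ : ℂˣ) : ℂ) = -1 ∧
      1 ≤ (distribHaarChar (LocalRing L v) t₀ : ℝ) := by
    by_cases hle : 1 ≤ (distribHaarChar (LocalRing L v) t₁ : ℝ)
    · exact ⟨t₁, ht₁, hχt₁, hle⟩
    · refine ⟨t₁⁻¹, map_units_inv_of_fixed (conjLocal L (IsCMField.complexConj L) v) t₁ ht₁, ?_, ?_⟩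
      · rw [map_inv, Units.val_inv_eq_inv_val, hχt₁, inv_neg, inv_one]
      · rw [not_le] at hle
        rw [map_inv, NNReal.coe_inv]
        exact (one_le_inv₀ (NNReal.coe_pos.2 distribHaarChar_pos)).2 hle.le
  set p : ℝ := (distribHaarChar (LocalRing L v) t₀ : ℝ) with hpdef
  have hdil_t : ∀ A' A'' : ℝ, I A' A'' = -I (A' / p) (A'' / p) := by
    intro A' A''
    rw [hdil t₀ ht₀ A' A'', Units.val_inv_eq_inv_val, hχt₀, inv_neg, inv_one, neg_one_mul]
  -- (5) the fixed unit `t₀ c` with `χ₁ = −1` and module `p q`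
  have htc : conjLocal L (IsCMField.complexConj L) v ((t₀ * c : (LocalRing L v)ˣ) : LocalRing L v) = (t₀ * c : (LocalRing L v)ˣ) := by
    rw [Units.val_mul, map_mul, ht₀, hcfix]
  have hdil_tc : ∀ A' A'' : ℝ, I A' A'' = -I (A' / (p * q)) (A'' / (p * q)) := by
    intro A' A''
    rw [hdil (t₀ * c) htc A' A'', map_mul, hχc, mul_one, Units.val_inv_eq_inv_val, hχt₀, inv_neg, inv_one, neg_one_mul, map_mul, NNReal.coe_mul]
  -- the abstract five lines
  exact annulus_eq_zero_of_dilations I hadd hq1 hdil_c hp hdil_t hdil_tc hA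

end Summit.HodgeConjecture.HodgeConjecture.R90.S4

end
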